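import Summits.Ventures.HodgeRepro2.T5CyclotomicSevenNonDyadic
import Summits.Ventures.HodgeRepro2.T5FinitePlaceClassification

/-!
# Row N2.2.2 on the field of record `ℚ(ζ₇)` at EVERY finite place of `ℚ(ζ₇)⁺`, from nothing
(cell pub-hodge-repro2, seat p3)

Tier-5 N2 support, rows N2.2.2 / N2.8.1 of route/T5-N2-route-3.md, instantiated on the field of record
`K7 = ℚ(ζ₇)` (p1's `CyclotomicSeven.K7`) with `K7⁺ = maximalRealSubfield K7`. File 152's datum is supplied by
file 145's square root of `−7`: `θ = −7 ∈ K7⁺`, `y = √−7 = 1 + 2(ζ + ζ² + ζ⁴) ∈ K7` with `c √−7 = −√−7 ≠ √−7`.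

* `algebraMap_neg_seven` / `complexConj_sqrtNegSeven_ne`: the datum `(−7, √−7)` of file 152 on `ℚ(ζ₇)`;
* **`classification_K7`**: at EVERY finite place `v` of `ℚ(ζ₇)⁺`, on `K7⁺_v ⊗ K7` with the conjugation `1 ⊗ c`:
  if `−7` is a `v`-adic square (the place splits) any two invertible hermitian matrices are congruent, otherwise
  they are congruent iff their determinants differ by a norm `star u · u`;
* `isCongruent_iff_hilbertSolvable_K7'` / `exists_two_classes_K7'`: row N2.8.1 (i)'s Hilbert-symbol criterion and
  HKS96's «precisely two classes» at the non-split places, on `K7⁺_v ⊗ K7`;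
* `isCongruent_of_not_isUnit_two`: at the dyadic place of `ℚ(ζ₇)⁺` (which splits, file 145) any two invertible
  hermitian matrices are congruent.

Nothing printed in the cone beyond Mathlib. Mathlib + p1's `CyclotomicSevenTypes`, this seat's files 145 and
115–152 and seat p4's chain through them only; no display; no device. §8(d): uses an L-value-free non-vanishing
device: NO.
-/

namespace Summit.Ventures.HodgeRepro2.T5CyclotomicSevenClassification

open IsDedekindDomain IsDedekindDomain.HeightOneSpectrum NumberField NumberField.IsCMField Module Matrix
open scoped TensorProduct
open Summit.Ventures.HodgeRepro2.CyclotomicSeven Summit.Ventures.HodgeRepro2.T5CyclotomicSevenNonDyadic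
  Summit.Ventures.HodgeRepro2.T5FinitePlaceSplitClassification Summit.Ventures.HodgeRepro2.T5HermitianDetClass
  Summit.Ventures.HodgeRepro2.T5HermitianClassify Summit.Ventures.HodgeRepro2.T5HilbertSymbolNorm
  Summit.Ventures.HodgeRepro2.T5FinitePlaceClassification

section Datum

/-- **The datum of the field of record:** `−7 ∈ ℚ(ζ₇)⁺` is the square of `√−7 ∈ ℚ(ζ₇)`. -/
theorem algebraMap_neg_seven : algebraMap (maximalRealSubfield K7) K7 (-7) = sqrtNegSeven ^ 2 := by
  rw [sqrtNegSeven_sq, map_neg, map_ofNat]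

/-- `√−7` is not fixed by the complex conjugation (`c √−7 = −√−7`, `√−7 ≠ 0`, characteristic zero). -/
theorem complexConj_sqrtNegSeven_ne : complexConj K7 sqrtNegSeven ≠ sqrtNegSeven := by
  rw [complexConj_sqrtNegSeven]
  intro h
  have h2 : (2 : K7) * sqrtNegSeven = 0 := by linear_combination -h
  exact sqrtNegSeven_ne_zero ((mul_eq_zero.1 h2).resolve_left two_ne_zero)

end Datum

section Places

variable (v : HeightOneSpectrum (𝓞 (maximalRealSubfield K7))) (w : HeightOneSpectrum (𝓞 K7))
  [w.asIdeal.LiesOver v.asIdeal]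

include w in
/-- **Row N2.2.2 on `ℚ(ζ₇)` at EVERY finite place of `ℚ(ζ₇)⁺`**, on the route's local algebra `K7⁺_v ⊗ K7`
with the conjugation `1 ⊗ c`: if `−7` is a `v`-adic square any two invertible hermitian matrices are congruent;
otherwise they are congruent iff their determinants differ by a norm. -/
theorem classification_K7 {n : Type*} [Fintype n] [DecidableEq n]
    {H H' : Matrix n n ((v.adicCompletion (maximalRealSubfield K7)) ⊗[maximalRealSubfield K7] K7)}
    (hH : letI := tensorStarRing K7 v; H.IsHermitian) (hH' : letI := tensorStarRing K7 v; H'.IsHermitian)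
    (hdet : IsUnit H.det) (hdet' : IsUnit H'.det) :
    letI := tensorStarRing K7 v
    (IsSquare (algebraMap (maximalRealSubfield K7) (v.adicCompletion (maximalRealSubfield K7)) (-7)) →
        IsCongruent H H') ∧
      (¬ IsSquare (algebraMap (maximalRealSubfield K7) (v.adicCompletion (maximalRealSubfield K7)) (-7)) →
        (IsCongruent H H' ↔ ∃ u : (v.adicCompletion (maximalRealSubfield K7)) ⊗[maximalRealSubfield K7] K7,
          u ≠ 0 ∧ H'.det = star u * u * H.det)) :=
  classification K7 algebraMap_neg_seven complexConj_sqrtNegSeven_ne v w hH hH' hdet hdet'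

include w in
/-- **Row N2.8.1 (i) on `ℚ(ζ₇)` at a non-split place, on `K7⁺_v ⊗ K7`:** Gram matrices with
`det H' = (a ⊗ 1) · det H` are congruent iff `(a, −7)_v = 1`. -/
theorem isCongruent_iff_hilbertSolvable_K7'
    (hsq : ¬ IsSquare (algebraMap (maximalRealSubfield K7) (v.adicCompletion (maximalRealSubfield K7)) (-7)))
    {n : Type*} [Fintype n] [DecidableEq n]
    {H H' : Matrix n n ((v.adicCompletion (maximalRealSubfield K7)) ⊗[maximalRealSubfield K7] K7)}
    (hH : letI := tensorStarRing K7 v; H.IsHermitian) (hH' : letI := tensorStarRing K7 v; H'.IsHermitian)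
    (hdet : IsUnit H.det) {a : v.adicCompletion (maximalRealSubfield K7)} (ha : a ≠ 0)
    (hdet' : H'.det = algebraMap (v.adicCompletion (maximalRealSubfield K7))
      ((v.adicCompletion (maximalRealSubfield K7)) ⊗[maximalRealSubfield K7] K7) a * H.det) :
    letI := tensorStarRing K7 v
    IsCongruent H H' ↔
      HilbertSolvable a (algebraMap (maximalRealSubfield K7) (v.adicCompletion (maximalRealSubfield K7)) (-7)) :=
  isCongruent_iff_hilbertSolvable_of_not_isSquare K7 algebraMap_neg_seven complexConj_sqrtNegSeven_ne v w hsq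
    hH hH' hdet ha hdet'

include w in
/-- **HKS96's «precisely two classes in each dimension» on `ℚ(ζ₇)` at a non-split place, on `K7⁺_v ⊗ K7`.** -/
theorem exists_two_classes_K7'
    (hsq : ¬ IsSquare (algebraMap (maximalRealSubfield K7) (v.adicCompletion (maximalRealSubfield K7)) (-7)))
    (m : ℕ) :
    letI := tensorStarRing K7 v
    ∃ H₁ H₂ : Matrix (Fin (m + 1)) (Fin (m + 1))
        ((v.adicCompletion (maximalRealSubfield K7)) ⊗[maximalRealSubfield K7] K7),
      H₁.IsHermitian ∧ H₂.IsHermitian ∧ IsUnit H₁.det ∧ IsUnit H₂.det ∧ ¬ IsCongruent H₁ H₂ ∧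
        ∀ H : Matrix (Fin (m + 1)) (Fin (m + 1))
          ((v.adicCompletion (maximalRealSubfield K7)) ⊗[maximalRealSubfield K7] K7),
          H.IsHermitian → IsUnit H.det → IsCongruent H H₁ ∨ IsCongruent H H₂ :=
  exists_two_classes_of_not_isSquare K7 algebraMap_neg_seven complexConj_sqrtNegSeven_ne v w hsq m

include w in
/-- **At the dyadic place of `ℚ(ζ₇)⁺`** (`2` not a unit of `O_{K7⁺_v}`; it splits in `ℚ(ζ₇)`, file 145) any two
invertible hermitian matrices over `K7⁺_v ⊗ K7` are congruent. -/
theorem isCongruent_of_not_isUnit_two (h2 : ¬ IsUnit (2 : adicCompletionIntegers (maximalRealSubfield K7) v))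
    {n : Type*} [Fintype n] [DecidableEq n]
    {H H' : Matrix n n ((v.adicCompletion (maximalRealSubfield K7)) ⊗[maximalRealSubfield K7] K7)}
    (hH : letI := tensorStarRing K7 v; H.IsHermitian) (hH' : letI := tensorStarRing K7 v; H'.IsHermitian)
    (hdet : IsUnit H.det) (hdet' : IsUnit H'.det) :
    letI := tensorStarRing K7 v
    IsCongruent H H' := by
  letI := tensorStarRing K7 v
  have hsq : IsSquare (algebraMap (maximalRealSubfield K7) (v.adicCompletion (maximalRealSubfield K7)) (-7)) :=
    by_contra fun hsq => h2 (isUnit_two_of_not_isSquare v algebraMap_neg_seven.symm hsq)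
  exact isCongruent_of_isSquare K7 algebraMap_neg_seven complexConj_sqrtNegSeven_ne v w hsq hH hH' hdet hdet'

end Places

end Summit.Ventures.HodgeRepro2.T5CyclotomicSevenClassification
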